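import Literature.MathematicalPhysics.QuantumFieldTheory.Balaban1985CMP102.SectB
import Summits.QuantumFields.Balaban3D.Proofs.NegativeEdge

/-!
# Bałaban CMP 102 (1985), d = 3 lane — `Proofs.EndTheorem`: THE END THEOREM over the SPINE'S OWN TOWER CARRIER
# (`SectB.TowerObjects`), with the carrier equations discharged — `Thm1AsPrintedCompact ∧ Thm2AsPrintedC` from the analytic
# leaves alone

Source: T. Bałaban, CMP **102** (1985) 255–275 [Balaban1985UV3]; Theorem 1 p. 257 = PDF 3 L4–7, Theorem 2 p. 272 = PDF 18 L35–37,
family clause p. 256 = PDF 2 L15–18.  Lane `pub-balaban3d`, seat p3 (PLAN §0.5 E4, §3.1 p3; rulings R-END, R-EPS0′, R-PIECES).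

ARCHITECTURE.  The spine's Sect. B (`SectB.TowerObjects S G`, typer-1) extends the Introduction's run objects by the binders of the
inductive hypothesis (41)/(47) — histories, the functional `LF` of (41), the minimizers `U_k(V,{V_j})` of (42), the interaction sum
(43), `|Λ_k|`, `|Z_j|`, the coefficient profiles `zcoef`/`rcoef` of the «O(log g_j⁻¹)|Z_j|» and «O((L^jε)^{3+κ₀})|T₁^{(j)}|» terms, the
step profile `E^{(j)}` with `E = E₀` (R-E) — and maps them to the 4D cell's `B10.TowerRun` (`toTowerRun`), pinning the abstract
slot «ρ_k satisfies (41), (47)» to the typed displays (`pin`, `specOK_pin`).  A TOWER CONSTRUCTION `mkT` (for every group as printed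
and every `S : Scales L`, such tower objects — the carrier seat's `run3` with the expansion data) induces the run-object construction
`mkT.toConstruction` of `Theorems.Construction` (pinned).  For it:
* §1 the CARRIER EQUATIONS `UVStability3D.CarrierEqs C S (W.pin.toTowerRun)` hold as soon as the tower objects `W` use the
  family's constants — `M₁, b₀, p₀, κ₀` and the j-independent remainder coefficient `rcoef j = rstar·(g²)^{3+κ₀}` (ruling R-NORM:
  `ScalesArithmetic.remainder_sum_literal_eq`) — and have `|Λ_k| ≥ 0`: `K`, `g_k`, `|T₁^{(k)}|` are the spine's BY `rfl`, `spec` is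
  `SectB.TowerObjects.specOK_pin` (`carrierEqs_pin`);
* §2 **THE END THEOREM** `uvStability3D`: analytic leaves `AnalyticLeaves C S (W.pin.toTowerRun)` on the exhibited family
  `S.ε₀ = ε₀(S.g) = (min γ₀ 1)²/S.g²` (there `g_k ≤ γ₀`) ⇒ **`Theorems.Thm1AsPrintedCompact mkT.toConstruction ∧
  Theorems.Thm2AsPrintedC mkT.toConstruction`**; and `uvStability3D_not_literal`: with one group of `d(𝔤) ≥ d₀ > 0` and the
  unit configuration, the literal `B10.Thm1Printed` fails on the same family (G-B10-01).
HONEST FRAMING (PLAN §0): the hypotheses ARE the analytic leaves of Sects. A/C/D over the concrete objects (owners p1, p2, p4–p6 per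
LEAF-LEDGER); nothing of them is asserted here.  No `sorry`, standard axioms.
-/

namespace Summit.QuantumFields.Balaban3D.Proofs.EndTheorem

open Literature.MathematicalPhysics.QuantumFieldTheory.Balaban1983to89
open Literature.MathematicalPhysics.QuantumFieldTheory.Balaban1983to89.B10
open Literature.MathematicalPhysics.QuantumFieldTheory.Balaban1983to89.B10SectAGathering
open Literature.MathematicalPhysics.QuantumFieldTheory.Balaban1985CMP102.Setting
open Literature.MathematicalPhysics.QuantumFieldTheory.Balaban1985CMP102.Theorems
open Literature.MathematicalPhysics.QuantumFieldTheory.Balaban1985CMP102.SectB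
open Summit.QuantumFields.Balaban3D.Proofs.ScalesArithmetic
open Summit.QuantumFields.Balaban3D.Proofs.Constants
open Summit.QuantumFields.Balaban3D.Proofs.UVStability3D
open Summit.QuantumFields.Balaban3D.Proofs.NegativeEdge

variable {L : ℕ}

/-! ## §0 Tower constructions and their run-object constructions -/

/-- A CONSTRUCTION AT THE TOWER LEVEL: for every group as printed and every lattice approximation, the tower objects of Sect. B
(`SectB.TowerObjects`: run objects (1)–(6) + the binders of (38)–(43), (62)/(64)). [cite: Balaban1985UV3, (38)–(43) p.266] -/
def TowerConstruction (L : ℕ) : Type 1 :=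
  ∀ (G : Type) [GaugeGroup G] [MeasurableSpace G] [HaarData G], GroupModel G → ∀ S : Scales L, TowerObjects S G

/-- The run-object construction of a tower construction, with the slot «ρ_k satisfies (41), (47)» PINNED to the typed displays
(`SectB.TowerObjects.pin`; densities unchanged, `pin_rho`). [cite: Balaban1985UV3, Thm 2 p.272] -/
noncomputable def TowerConstruction.toConstruction (mkT : TowerConstruction L) : Construction L :=
  fun G _ _ _ 𝔊 S => (mkT G 𝔊 S).pin.toRunObjects

/-- The pinned towers of a tower construction (the `tower` argument of `Proofs.UVStability3D`). [folklore] -/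
noncomputable def TowerConstruction.tower (mkT : TowerConstruction L) :
    ∀ (G : Type) [GaugeGroup G] [MeasurableSpace G] [HaarData G], GroupModel G → Scales L → TowerRun :=
  fun G _ _ _ 𝔊 S => (mkT G 𝔊 S).pin.toTowerRun

/-- The towers project to the pinned run objects — definitionally (`SectB.TowerObjects.toTowerRun.toRunData := toRunData`). [folklore] -/
theorem TowerConstruction.tower_toRunData (mkT : TowerConstruction L) (G : Type) [GaugeGroup G] [MeasurableSpace G] [HaarData G]
    (𝔊 : GroupModel G) (S : Scales L) :
    (mkT.tower G 𝔊 S).toRunData = (mkT.toConstruction G 𝔊 S).toRunData := rfl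

/-! ## §1 The carrier equations for the spine's tower carrier -/

section Carrier

variable {S : Scales L} {G : Type} [GaugeGroup G] [MeasurableSpace G] [HaarData G]

/-- WHAT THE TOWER OBJECTS MUST TAKE FROM THE FAMILY'S CONSTANTS for the carrier equations to close: `M₁, b₀, p₀` ((7) p. 257, (38)),
`κ₀` (p. 262), the remainder coefficients of (41) `rcoef j = rstar·(g²)^{3+κ₀}` (j-independent; R-NORM: then «Σ_j rcoef_j (L^jε)^{3+κ₀}
|T₁^{(j)}|» = `rstar·Σ_j (g_j²)^{3+κ₀}|T₁^{(j)}|`), and `|Λ_k| ≥ 0`.  (For the carrier seat: all `rfl` if `run3` is DEFINED with these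
values.) [cite: Balaban1985UV3, (7) p.257 + (41) p.266] -/
structure UsesConsts (C : B10Assembly.Consts) (W : TowerObjects S G) : Prop where
  M₁_eq : W.M₁ = C.M₁
  b₀_eq : W.b₀ = C.b₀
  p₀_eq : W.p₀ = C.p₀
  κ₀_eq : W.κ₀ = C.κ₀
  rcoef_eq : ∀ j, W.rcoef j = C.rstar * (S.g ^ 2) ^ (3 + C.κ₀)
  Λvol_nonneg : ∀ (k : ℕ) (h : W.Hist k), 0 ≤ W.Λvol k h

/-- **THE CARRIER EQUATIONS HOLD FOR THE SPINE'S (PINNED) TOWER**: `K`, `g_k`, `|T₁^{(k)}|` by `rfl`; `M₁, b₀, p₀` and the remainder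
sum by `UsesConsts` + `ScalesArithmetic.remainder_sum_literal_eq`; the (41)/(47) slot by `SectB.TowerObjects.specOK_pin`.
[cite: Balaban1985UV3, (41) p.266 + Thm 2 p.272] -/
theorem carrierEqs_pin {C : B10Assembly.Consts} (W : TowerObjects S G) (hW : UsesConsts C W) :
    CarrierEqs C S W.pin.toTowerRun where
  K_eq := rfl
  g_eq _ := rfl
  sites_eq _ := rfl
  par := ⟨hW.M₁_eq, hW.b₀_eq, hW.p₀_eq⟩
  Rm_eq k := by
    show ∑ j ∈ Finset.range k, W.rcoef j * ((L : ℝ) ^ j * S.ε) ^ (3 + W.κ₀) * S.sites j = _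
    simp_rw [hW.rcoef_eq, hW.κ₀_eq]
    exact remainder_sum_literal_eq S C.rstar C.κ₀ k
  Λvol_nonneg := hW.Λvol_nonneg
  spec := W.specOK_pin

end Carrier

/-! ## §2 The end theorem -/

/-- **THE END THEOREM OF THE LANE** (PLAN §0.5 E4).  Let `mkT` be a tower construction (the carrier seat's `run3` with the expansion
data, for every group as printed and every lattice approximation), `C` normalised family constants (`Constants.consts3 F sc`:
`NormalisedConsts L C`) used by the towers (`UsesConsts`), and `γ₀ > 0` the minimum of the leaf seats' smallness thresholds.  IF on
the exhibited family `S.ε₀ = ε₀(S.g) = (min γ₀ 1)²/S.g²` (where every `g_k ≤ γ₀`, `ScalesArithmetic.gk_le_gamma0_of_eps0Of`) the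
ANALYTIC LEAVES of Sects. A/C/D hold for the concrete objects (`AnalyticLeaves C S (pinned tower)`: `step0`, `noInt0`, the fourteen
step leaves per k < K, `bound46`, `logZT_le`, `PprT_le`, `lf`, and the piece equations `starT_eq`, `rem_eq`, `logσ₀_le`, `dg_le`),
THEN **`Theorems.Thm1AsPrintedCompact mkT.toConstruction ∧ Theorems.Thm2AsPrintedC mkT.toConstruction`** — Theorem 1 p. 257 (bounds
(5), compact-coupling-window reading, «O(1) independent of ε, k, g_k in a bounded set», displayed as the 4D cell's
`B10Assembly.O1 C gmin gmax`) and Theorem 2 p. 272 ((41) ∧ (47) for k ≤ K), each with «ε₀ … depending on the coupling constant g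
only» witnessed by `ε₀(g)`.  Kernel bookkeeping over `B10Assembly.thm1Compact_and_thm2_of_leafSystem`; every analytic input a named
hypothesis. [cite: Balaban1985UV3, Thm 1 p.257 + Thm 2 p.272 + p.256 L15–18] -/
theorem uvStability3D (mkT : TowerConstruction L) (C : B10Assembly.Consts) (hC : NormalisedConsts L C)
    (hW : ∀ (G : Type) [GaugeGroup G] [MeasurableSpace G] [HaarData G] (𝔊 : GroupModel G) (S : Scales L),
      UsesConsts C (mkT G 𝔊 S))
    {γ₀ : ℝ} (hγ : 0 < γ₀)
    (A : ∀ (G : Type) [GaugeGroup G] [MeasurableSpace G] [HaarData G] (𝔊 : GroupModel G) (S : Scales L),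
      S.ε₀ = eps0Of γ₀ S.g → AnalyticLeaves C S (mkT G 𝔊 S).pin.toTowerRun) :
    Thm1AsPrintedCompact mkT.toConstruction ∧ Thm2AsPrintedC mkT.toConstruction :=
  uvStability3D_asPrinted mkT.toConstruction C hC mkT.tower (fun G _ _ _ 𝔊 S => mkT.tower_toRunData G 𝔊 S) hγ
    (fun G _ _ _ 𝔊 S hS => { toCarrierEqs := carrierEqs_pin (mkT G 𝔊 S) (hW G 𝔊 S), toAnalyticLeaves := A G 𝔊 S hS })

/-- **THE LITERAL READING FAILS ON THE SAME FAMILY** (G-B10-01 for the lane; PLAN §0.4): under the hypotheses of `uvStability3D` for ONE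
group as printed whose step pieces have `d(𝔤) ≥ d₀ > 0` ((R3): any non-discrete G) and whose towers carry the unit configuration at
level 0 ((R1) `B10DagLeaf.UnitConfig0`: `U ≡ 1` with `A(1) = 0`, `χ(1) = 1`), with `ε₀(g) = (min γ₀ 1)²/g²`:
`(B10.Thm1PrintedCompact ∧ B10.Thm2Printed) ∧ ¬ B10.Thm1Printed` on `Theorems.runs mkT.toConstruction G 𝔊 (eps0Of γ₀)`.
[cite: Balaban1985UV3, Thm 1 p.257 + (62) p.271] -/
theorem uvStability3D_not_literal (mkT : TowerConstruction L) (C : B10Assembly.Consts) (hC : NormalisedConsts L C)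
    (hL : Odd L ∧ 1 < L) {γ₀ : ℝ} (hγ : 0 < γ₀)
    (G : Type) [GaugeGroup G] [MeasurableSpace G] [HaarData G] (𝔊 : GroupModel G)
    (hW : ∀ S : Scales L, UsesConsts C (mkT G 𝔊 S))
    (A : ∀ S : Scales L, S.ε₀ = eps0Of γ₀ S.g → AnalyticLeaves C S (mkT G 𝔊 S).pin.toTowerRun)
    {d₀ : ℝ} (hd : 0 < d₀)
    (hD : ∀ (S : Scales L) (hS : S.ε₀ = eps0Of γ₀ S.g) (k : ℕ) (hk : k + 1 ≤ S.K), d₀ ≤ ((A S hS).steps k hk).P.dg)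
    (hU : ∀ S : Scales L, S.ε₀ = eps0Of γ₀ S.g → B10DagLeaf.UnitConfig0 (mkT G 𝔊 S).pin.toTowerRun) :
    (Thm1PrintedCompact (runs mkT.toConstruction G 𝔊 (eps0Of γ₀)) ∧ Thm2Printed (runs mkT.toConstruction G 𝔊 (eps0Of γ₀)))
      ∧ ¬ Thm1Printed (runs mkT.toConstruction G 𝔊 (eps0Of γ₀)) :=
  compact_not_literal_eps0 mkT.toConstruction C hC mkT.tower (fun G _ _ _ 𝔊 S => mkT.tower_toRunData G 𝔊 S) hL hγ G 𝔊
    (fun S hS => { toCarrierEqs := carrierEqs_pin (mkT G 𝔊 S) (hW S), toAnalyticLeaves := A S hS }) hd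
    (fun S hS k hk => hD S hS k hk) hU

/-! ## §3 Leaves proved over the UNPINNED tower transport to the pinned one

The leaf seats naturally work over `W.toTowerRun` (spine `SectB.Ineq41AsPrinted`/`Ineq47AsPrinted`); the assembly needs the pinned tower
(for `spec`).  The two towers differ only in the slot and — propositionally, `SectB.TowerObjects.pin_rho` — in the recursively defined
densities; every other field is definitionally the same.  So step pieces, step leaves and the analytic bundle TRANSPORT. -/

section Pin

variable {S : Scales L} {G : Type} [GaugeGroup G] [MeasurableSpace G] [HaarData G] (W : TowerObjects S G)

/-- Step pieces over `W.toTowerRun` ARE step pieces over `W.pin.toTowerRun` (same fields). [folklore] -/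
def piecesPin {k : ℕ} (P : B10SectAGathering.StepPieces W.toTowerRun k) : B10SectAGathering.StepPieces W.pin.toTowerRun k where
  proj := P.proj
  proj_triv := P.proj_triv
  Zvol := P.Zvol
  Zvol_nonneg := P.Zvol_nonneg
  Zvol_triv := P.Zvol_triv
  starB := P.starB
  starT := P.starT
  logσ₀ := P.logσ₀
  dg := P.dg
  dg_nonneg := P.dg_nonneg
  logZU := P.logZU
  logZ1 := P.logZ1
  logZT := P.logZT
  logFl := P.logFl
  PprU := P.PprU
  Ppr1 := P.Ppr1
  PprT := P.PprT
  PY := P.PY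
  PYZ := P.PYZ
  Pold := P.Pold
  PoldIn := P.PoldIn
  rem := P.rem
  rem_nonneg := P.rem_nonneg

/-- The fourteen step leaves transport from `W.toTowerRun` to `W.pin.toTowerRun` ((22)/(55) and its lower twin through
`SectB.TowerObjects.pin_rho`, `ineq41_pin_iff`, `ineq47_pin_iff`; the other twelve verbatim). [folklore] -/
noncomputable def leavesPin {k : ℕ} (Sl : B10SectAGathering.StepLeaves W.toTowerRun k) :
    B10SectAGathering.StepLeaves W.pin.toTowerRun k where
  P := piecesPin W Sl.P
  Cz := Sl.Cz
  C₁ := Sl.C₁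
  C₁' := Sl.C₁'
  C₂ := Sl.C₂
  Cv := Sl.Cv
  C₃ := Sl.C₃
  C₄ := Sl.C₄
  C₅ := Sl.C₅
  c₁ := Sl.c₁
  C₆ := Sl.C₆
  bound55 := fun h41 U => by
    have h := Sl.bound55 ((W.ineq41_pin_iff k).mp h41) U
    have hρ : W.pin.toTowerRun.ρ (k + 1) U = W.toTowerRun.ρ (k + 1) U := congrFun (W.pin_rho (k + 1)) U
    rw [hρ]
    exact h
  bound55Lower := fun h47 U => by
    have h := Sl.bound55Lower ((W.ineq47_pin_iff k).mp h47) U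
    have hρ : W.pin.toTowerRun.ρ (k + 1) U = W.toTowerRun.ρ (k + 1) U := congrFun (W.pin_rho (k + 1)) U
    rw [hρ]
    exact h
  cumulant58 := Sl.cumulant58
  cumulantLower := Sl.cumulantLower
  repr33_60 := Sl.repr33_60
  vacuumWhole := Sl.vacuumWhole
  decomp35_61 := Sl.decomp35_61
  norm35 := Sl.norm35
  starCount := Sl.starCount
  oldOutside := Sl.oldOutside
  pintSucc := Sl.pintSucc
  estep62 := Sl.estep62
  ztermSucc := Sl.ztermSucc
  rmSucc := Sl.rmSucc

/-- **THE ANALYTIC BUNDLE TRANSPORTS TO THE PINNED TOWER**: leaves proved over the spine's `W.toTowerRun` (the natural carrier of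
`SectB.Ineq41AsPrinted`/`Ineq47AsPrinted`) give `AnalyticLeaves C S W.pin.toTowerRun` — (41)₀/(47)₀ through `ineq41_pin_iff`/`ineq47_pin_iff`,
the step leaves through `leavesPin`, the rest verbatim. [folklore] -/
noncomputable def analyticLeavesPin {C : B10Assembly.Consts} (A : AnalyticLeaves C S W.toTowerRun) :
    AnalyticLeaves C S W.pin.toTowerRun where
  step0 := ⟨(W.ineq41_pin_iff 0).mpr A.step0.1, (W.ineq47_pin_iff 0).mpr A.step0.2⟩
  noInt0 := A.noInt0
  steps := fun k hk => leavesPin W (A.steps k hk)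
  bound46 := A.bound46
  logZT_le := fun k hk => A.logZT_le k hk
  PprT_le := fun k hk => A.PprT_le k hk
  lf := A.lf
  starT_eq := fun k hk => A.starT_eq k hk
  logσ₀_le := fun k hk => A.logσ₀_le k hk
  dg_le := fun k hk => A.dg_le k hk
  rem_eq := fun k hk => A.rem_eq k hk

end Pin

/-- **THE END THEOREM WITH LEAVES OVER THE UNPINNED TOWERS** (the form the leaf seats instantiate): as `uvStability3D`, but the analytic
bundles are taken over `(mkT G 𝔊 S).toTowerRun` and transported by `analyticLeavesPin`. [cite: Balaban1985UV3, Thm 1 p.257 + Thm 2 p.272] -/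
theorem uvStability3D' (mkT : TowerConstruction L) (C : B10Assembly.Consts) (hC : NormalisedConsts L C)
    (hW : ∀ (G : Type) [GaugeGroup G] [MeasurableSpace G] [HaarData G] (𝔊 : GroupModel G) (S : Scales L),
      UsesConsts C (mkT G 𝔊 S))
    {γ₀ : ℝ} (hγ : 0 < γ₀)
    (A : ∀ (G : Type) [GaugeGroup G] [MeasurableSpace G] [HaarData G] (𝔊 : GroupModel G) (S : Scales L),
      S.ε₀ = eps0Of γ₀ S.g → AnalyticLeaves C S (mkT G 𝔊 S).toTowerRun) :
    Thm1AsPrintedCompact mkT.toConstruction ∧ Thm2AsPrintedC mkT.toConstruction :=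
  uvStability3D mkT C hC hW hγ (fun G _ _ _ 𝔊 S hS => analyticLeavesPin (mkT G 𝔊 S) (A G 𝔊 S hS))

/-! ## §4 The end theorem with GROUP-DEPENDENT constants and threshold

`Theorems.Thm1AsPrintedCompact mk` reads «∀ (group as printed), ∃ eps0, …»: the terminal spacing `ε₀(g)` — hence the lane's
threshold `γ₀` — and the O(1)'s may depend on the group (print fixes ONE group G throughout; its constants `σ₀ = σ(0)` of
(18) p. 260, `d(𝔤)` of (22) p. 261, `N` of `G ⊂ U(N)` enter the O(1)'s).  The form below lets the constants record `C`, the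
threshold `γ₀` and the analytic bundle be supplied PER GROUP; it is the shape `Proofs.Inputs` instantiates. -/

/-- **THE END THEOREM, constants and threshold per group** (PLAN §0.5 E4): for a tower construction `mkT`, and FOR EVERY GROUP
AS PRINTED a normalised constants record `C G 𝔊` used by the towers, a threshold `γ₀ G 𝔊 > 0`, and the analytic leaves over the
pinned towers on the exhibited family `S.ε₀ = ε₀(S.g) = (min (γ₀ G 𝔊) 1)²/S.g²`:
**`Theorems.Thm1AsPrintedCompact mkT.toConstruction ∧ Theorems.Thm2AsPrintedC mkT.toConstruction`**.
[cite: Balaban1985UV3, Thm 1 p.257 + Thm 2 p.272 + p.256 L15–18] -/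
theorem uvStability3D_grp (mkT : TowerConstruction L)
    (C : ∀ (G : Type) [GaugeGroup G] [MeasurableSpace G] [HaarData G], GroupModel G → B10Assembly.Consts)
    (hC : ∀ (G : Type) [GaugeGroup G] [MeasurableSpace G] [HaarData G] (𝔊 : GroupModel G), NormalisedConsts L (C G 𝔊))
    (hW : ∀ (G : Type) [GaugeGroup G] [MeasurableSpace G] [HaarData G] (𝔊 : GroupModel G) (S : Scales L),
      UsesConsts (C G 𝔊) (mkT G 𝔊 S))
    (γ₀ : ∀ (G : Type) [GaugeGroup G] [MeasurableSpace G] [HaarData G], GroupModel G → ℝ)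
    (hγ : ∀ (G : Type) [GaugeGroup G] [MeasurableSpace G] [HaarData G] (𝔊 : GroupModel G), 0 < γ₀ G 𝔊)
    (A : ∀ (G : Type) [GaugeGroup G] [MeasurableSpace G] [HaarData G] (𝔊 : GroupModel G) (S : Scales L),
      S.ε₀ = eps0Of (γ₀ G 𝔊) S.g → AnalyticLeaves (C G 𝔊) S (mkT G 𝔊 S).pin.toTowerRun) :
    Thm1AsPrintedCompact mkT.toConstruction ∧ Thm2AsPrintedC mkT.toConstruction := by
  have key : ∀ (G : Type) [GaugeGroup G] [MeasurableSpace G] [HaarData G] (𝔊 : GroupModel G),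
      Thm1PrintedCompact (runs mkT.toConstruction G 𝔊 (eps0Of (γ₀ G 𝔊)))
        ∧ Thm2Printed (runs mkT.toConstruction G 𝔊 (eps0Of (γ₀ G 𝔊))) := by
    intro G _ _ _ 𝔊
    exact uvStability3D_compact_subfamily mkT.toConstruction (C G 𝔊) (hC G 𝔊) mkT.tower
      (fun G _ _ _ 𝔊 S => mkT.tower_toRunData G 𝔊 S) (fun S : Family L (eps0Of (γ₀ G 𝔊)) => S.1) G 𝔊
      (fun S => { toCarrierEqs := carrierEqs_pin (mkT G 𝔊 S.1) (hW G 𝔊 S.1), toAnalyticLeaves := A G 𝔊 S.1 S.2 })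
  constructor
  · intro G _ _ _ 𝔊
    exact ⟨eps0Of (γ₀ G 𝔊), fun _ hg => eps0Of_pos (hγ G 𝔊) hg, (key G 𝔊).1⟩
  · intro G _ _ _ 𝔊
    exact ⟨eps0Of (γ₀ G 𝔊), fun _ hg => eps0Of_pos (hγ G 𝔊) hg, (key G 𝔊).2⟩

end Summit.QuantumFields.Balaban3D.Proofs.EndTheorem
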